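import Summits.Ventures.PercRepro.ProfilePointedCircuitClassesFive

/-!
# PercRepro — THE BOTTOM-LEVEL PER-CIRCUIT CLAIM AT NULLITY 5, VI: THE CLASS `#C = 2` IS THE PER-POINT IN–OUT
INEQUALITY AT THE BOTTOM OF NULLITY 4 (p5, gen 37; `proofs/P5-GM1.md` §53(a), the case `c = 2` of the reduction)

When the fundamental circuit of `x` in a captured set is the triangle `{x, w₁, w₂}`, the class at every level `k` is
`{W ∈ BI_k : w₁, w₂ ∈ W, x ∉ W}`, in bijection (`W ↦ W − w₁`) with the bi-independent `(k − 1)`-sets of the minor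
`N° := N ／ x ∖ w₁` CONTAINING `w₂` — a matroid of nullity `4` and rank `ρ(E) − 1 ≥ 6` on `n − 2` points
(`w₁ ∈ cl{x, w₂}` makes `ρ_N(X + x) = ρ_N(X + w₁)` for every `X ∋ w₂`, so `W` is bi-independent in `N` iff `W − w₁`
is bi-independent in `N°`).  So the per-circuit claim `γ_C(5) ≤ γ_C(n − 6)` is `in_4(w₂) ≤ in_{n−7}(w₂) = out_5(w₂)`
on `N°`: THE PER-POINT IN–OUT INEQUALITY AT THE BOTTOM OF NULLITY 4, stated here as the CONJECTURE def
`InOutBottomFour` (NOT asserted; census-true, §53(b)–(d)) and carried as a hypothesis.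

* `InOutBottomFour` (conjecture def), `inCount_sub_eq_outCount` (complementation of the pointed counts),
  **`gammaC_five_le_of_card_eq_two_of_inout`**.
-/

open scoped Matroid

namespace PercRepro.Cogirth

open Finset ThmH Skew Shadow Profile

variable {α : Type} [DecidableEq α] {N : Matroid α} [N.Finite]

section FiveTwo

/-- **THE PER-POINT IN–OUT INEQUALITY AT THE BOTTOM OF NULLITY 4** (a `Prop`; a CONJECTURE, NOT asserted; §53(c)–(d)):
on every finite matroid with `#E = ρ(E) + 4` and `ρ(E) ≥ 6`, for every point `e`, `in_4(e) ≤ out_5(e)` — the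
bi-independent `4`-sets containing `e` are at most the bi-independent `5`-sets avoiding `e` (by complementation:
the bi-independent bases avoiding `e` are at most the bi-independent `(ρ − 1)`-sets containing `e`).  It is the
per-set refinement `(A_S)` of Theorem A's step for `S = {e}`; 0 violations on 26,616 random nullity-4 matroids at
`n = 10` (263,664 points) and on every level `2k + 2 ≤ n` there (§53(b)); the relation `Y = B − 3 + e + 1` carries its
local LYM on every instance tested (§53(d)); no proof yet. -/
def InOutBottomFour (α : Type) [DecidableEq α] : Prop :=
  ∀ (N : Matroid α) [N.Finite] (e : α), e ∈ gr N → (gr N).card = rk N (gr N) + 4 → 6 ≤ rk N (gr N) →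
    inCount N 4 e ≤ outCount N 5 e

/-- Complementation of the pointed counts: `in_{n−k}(p) = out_k(p)` (`X ↦ E ∖ X`). -/
theorem inCount_sub_eq_outCount {M : Matroid α} [M.Finite] {k : ℕ} {p : α} (hp : p ∈ gr M)
    (hk : k ≤ (gr M).card) : inCount M ((gr M).card - k) p = outCount M k p := by
  unfold inCount outCount
  symm
  apply card_bij (fun X _ => gr M \ X)
  · intro X hX
    rw [mem_filter] at hX ⊢
    exact ⟨sdiff_mem_biIndepSets hX.1, mem_sdiff.2 ⟨hp, hX.2⟩⟩
  · intro X₁ hX₁ X₂ hX₂ h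
    have h₁ : X₁ ⊆ gr M := (mem_biIndepSets.1 (mem_filter.1 hX₁).1).1
    have h₂ : X₂ ⊆ gr M := (mem_biIndepSets.1 (mem_filter.1 hX₂).1).1
    rw [← Finset.sdiff_sdiff_eq_self h₁, ← Finset.sdiff_sdiff_eq_self h₂, h]
  · intro Y hY
    rw [mem_filter] at hY
    have hYg : Y ⊆ gr M := (mem_biIndepSets.1 hY.1).1
    refine ⟨gr M \ Y, ?_, Finset.sdiff_sdiff_eq_self hYg⟩
    rw [mem_filter]
    refine ⟨?_, fun h => (mem_sdiff.1 h).2 hY.2⟩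
    have := sdiff_mem_biIndepSets hY.1
    rwa [Nat.sub_sub_self hk] at this

/-- **THE CLASS `#C = 2` AT NULLITY 5 MODULO THE IN–OUT INEQUALITY AT NULLITY 4** (§53(a), `c = 2`): the class of the
triangle `{x, w₁, w₂}` at the level `k` is `{W ∈ BI_k : w₁, w₂ ∈ W, x ∉ W} ≅ {X ∈ BI_{k−1}(N ／ x ∖ w₁) : w₂ ∈ X}`, so
`γ_C(5) ≤ γ_C(n − 6)` is `in_4(w₂) ≤ in_{n−7}(w₂) = out_5(w₂)` on `N ／ x ∖ w₁` (nullity `4`, rank `ρ(E) − 1 ≥ 6`). -/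
theorem gammaC_five_le_of_card_eq_two_of_inout (hio : InOutBottomFour α)
    (hn : (gr N).card = rk N (gr N) + 5) (hR : 7 ≤ rk N (gr N))
    (x : α) {C : Finset α} (hC : C.card = 2) : gammaC N 5 x C ≤ gammaC N ((gr N).card - 6) x C := by
  obtain ⟨w₁, w₂, hw12, rfl⟩ := card_eq_two.1 hC
  unfold gammaC
  rcases ((biIndepSets N 5).filter (fun W => x ∉ W ∧ x ∈ clF N W ∧ fundC N W x = {w₁, w₂})).eq_empty_or_nonempty
    with hemp | ⟨W₀, hW₀⟩
  · rw [hemp, card_empty]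
    exact Nat.zero_le _
  rw [mem_filter, mem_biIndepSets] at hW₀
  obtain ⟨⟨hW₀g, hW₀card, hW₀rk, hW₀compl⟩, hxW₀, hxcl₀, hfund₀⟩ := hW₀
  have hCW₀ : {w₁, w₂} ⊆ W₀ := hfund₀ ▸ fundC_subset W₀ x
  have hw₁W₀ : w₁ ∈ W₀ := hCW₀ (mem_insert_self _ _)
  have hw₂W₀ : w₂ ∈ W₀ := hCW₀ (mem_insert_of_mem (mem_singleton_self _))
  have hw₁g : w₁ ∈ gr N := hW₀g hw₁W₀
  have hw₂g : w₂ ∈ gr N := hW₀g hw₂W₀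
  have hxg : x ∈ gr N := clF_subset_gr W₀ hxcl₀
  have hxw₁ : x ≠ w₁ := fun h => hxW₀ (h ▸ hw₁W₀)
  have hxw₂ : x ≠ w₂ := fun h => hxW₀ (h ▸ hw₂W₀)
  -- the triangle `{x, w₁, w₂}`: `x ∈ cl{w₁, w₂}`, `x ∉ cl{w₂}`, `x ∉ cl{w₁}`
  have hxcl12 : x ∈ clF N {w₁, w₂} := by
    have h := mem_clF_sdiff_of_forall_notMem_fundC hxg hW₀g hW₀rk hxcl₀ (W₀ \ {w₁, w₂}) sdiff_subset
      (fun w hw => by rw [hfund₀]; exact (mem_sdiff.1 hw).2)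
    rwa [Finset.sdiff_sdiff_eq_self hCW₀] at h
  have hxn2 : x ∉ clF N {w₂} := by
    intro h
    have hw₁f : w₁ ∈ fundC N W₀ x := by rw [hfund₀]; exact mem_insert_self _ _
    unfold fundC at hw₁f
    rw [mem_filter] at hw₁f
    exact hw₁f.2 (mem_clF_of_subset (singleton_subset_iff.2 (mem_erase.2 ⟨hw12.symm, hw₂W₀⟩)) h)
  have hxn1 : x ∉ clF N {w₁} := by
    intro h
    have hw₂f : w₂ ∈ fundC N W₀ x := by rw [hfund₀]; exact mem_insert_of_mem (mem_singleton_self _)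
    unfold fundC at hw₂f
    rw [mem_filter] at hw₂f
    exact hw₂f.2 (mem_clF_of_subset (singleton_subset_iff.2 (mem_erase.2 ⟨hw12, hw₁W₀⟩)) h)
  have hr12 : rk N {w₁, w₂} = 2 := by
    have h := rk_eq_card_of_subset_of_rk_eq_card hCW₀ hW₀rk
    rwa [card_pair hw12] at h
  have hr1 : rk N {w₁} = 1 := by
    have h := rk_eq_card_of_subset_of_rk_eq_card (singleton_subset_iff.2 hw₁W₀) hW₀rk
    rwa [card_singleton] at h
  have hr2 : rk N {w₂} = 1 := by
    have h := rk_eq_card_of_subset_of_rk_eq_card (singleton_subset_iff.2 hw₂W₀) hW₀rk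
    rwa [card_singleton] at h
  have hrx12 : rk N (insert x {w₁, w₂}) = 2 := by
    rw [rk_insert_eq hxg (insert_subset hw₁g (singleton_subset_iff.2 hw₂g)), if_pos hxcl12, hr12]
  have hrx2 : rk N (insert x {w₂}) = 2 := by
    rw [rk_insert_eq hxg (singleton_subset_iff.2 hw₂g), if_neg hxn2, hr2]
  have hrx1 : rk N (insert x {w₁}) = 2 := by
    rw [rk_insert_eq hxg (singleton_subset_iff.2 hw₁g), if_neg hxn1, hr1]
  -- `w₁ ∈ cl{x, w₂}` and `w₂ ∈ cl{x, w₁}`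
  have hw₁cl : w₁ ∈ clF N (insert x {w₂}) := by
    by_contra h
    have e : insert w₁ (insert x ({w₂} : Finset α)) = insert x ({w₁, w₂} : Finset α) := by
      ext a; simp only [mem_insert, mem_singleton]; tauto
    have h1 := rk_insert_eq hw₁g (insert_subset hxg (singleton_subset_iff.2 hw₂g)) (M := N) (e := w₁)
      (X := insert x {w₂})
    rw [if_neg h, e, hrx12, hrx2] at h1
    omega
  have hw₂cl : w₂ ∈ clF N (insert x {w₁}) := by
    by_contra h
    have e : insert w₂ (insert x ({w₁} : Finset α)) = insert x ({w₁, w₂} : Finset α) := by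
      ext a; simp only [mem_insert, mem_singleton]; tauto
    have h1 := rk_insert_eq hw₂g (insert_subset hxg (singleton_subset_iff.2 hw₁g)) (M := N) (e := w₂)
      (X := insert x {w₁})
    rw [if_neg h, e, hrx12, hrx1] at h1
    omega
  -- the class at every level is `{W ∈ BI_k : w₁, w₂ ∈ W, x ∉ W}`
  have hclass : ∀ k : ℕ, ∀ W ∈ biIndepSets N k,
      ((x ∉ W ∧ x ∈ clF N W ∧ fundC N W x = {w₁, w₂}) ↔ ({w₁, w₂} ⊆ W ∧ x ∉ W)) := by
    intro k W hW
    rw [mem_biIndepSets] at hW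
    obtain ⟨hWg, hWcard, hWrk, hWcompl⟩ := hW
    constructor
    · rintro ⟨hxW, _, hfund⟩
      exact ⟨hfund ▸ fundC_subset W x, hxW⟩
    · rintro ⟨hCW, hxW⟩
      have hxcl : x ∈ clF N W := mem_clF_of_subset hCW hxcl12
      refine ⟨hxW, hxcl, ?_⟩
      have hw₁W : w₁ ∈ W := hCW (mem_insert_self _ _)
      have hw₂W : w₂ ∈ W := hCW (mem_insert_of_mem (mem_singleton_self _))
      -- for `w, v ∈ W`, `v ≠ w`, `w ∈ cl{x, v}`: `x ∉ cl(W − w)`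
      have key : ∀ w v : α, w ∈ W → v ∈ W → v ≠ w → w ∈ clF N (insert x {v}) → x ∉ clF N (W.erase w) := by
        intro w v hwW hvW hvw hwcl hx'
        have hWe : W.erase w ⊆ gr N := (erase_subset w W).trans hWg
        have r1 : rk N (insert x (W.erase w)) = rk N (W.erase w) := by
          rw [rk_insert_eq hxg hWe, if_pos hx']
        have hwcl' : w ∈ clF N (insert x (W.erase w)) :=
          mem_clF_of_subset (insert_subset_insert x (singleton_subset_iff.2 (mem_erase.2 ⟨hvw, hvW⟩))) hwcl
        have r2 : rk N (insert w (insert x (W.erase w))) = rk N (insert x (W.erase w)) := by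
          rw [rk_insert_eq (hWg hwW) ((insert_subset_iff).2 ⟨hxg, hWe⟩), if_pos hwcl']
        have e : insert w (insert x (W.erase w)) = insert x W := by
          ext a
          simp only [mem_insert, mem_erase]
          constructor
          · rintro (rfl | rfl | ⟨_, h⟩)
            · exact Or.inr hwW
            · exact Or.inl rfl
            · exact Or.inr h
          · rintro (rfl | h)
            · exact Or.inr (Or.inl rfl)
            · by_cases haw : a = w
              · exact Or.inl haw
              · exact Or.inr (Or.inr ⟨haw, h⟩)
        have r3 : rk N (insert x W) = rk N W := by rw [rk_insert_eq hxg hWg, if_pos hxcl]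
        have rWe : rk N (W.erase w) = W.card - 1 := by
          rw [rk_eq_card_of_subset_of_rk_eq_card (erase_subset w W) hWrk, card_erase_of_mem hwW]
        have hW1 : 1 ≤ W.card := card_pos.2 ⟨w, hwW⟩
        rw [e, r3, r1, rWe, hWrk] at r2
        omega
      ext w
      unfold fundC
      rw [mem_filter, mem_insert, mem_singleton]
      constructor
      · rintro ⟨hwW, hx'⟩
        by_contra hne
        rw [not_or] at hne
        have hsub : {w₁, w₂} ⊆ W.erase w := by
          intro a ha
          rw [mem_insert, mem_singleton] at ha
          rw [mem_erase]
          rcases ha with rfl | rfl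
          · exact ⟨fun h => hne.1 h.symm, hw₁W⟩
          · exact ⟨fun h => hne.2 h.symm, hw₂W⟩
        exact hx' (mem_clF_of_subset hsub hxcl12)
      · intro hw
        rcases hw with h | h
        · rw [h]
          exact ⟨hw₁W, key w₁ w₂ hw₁W hw₂W hw12.symm hw₁cl⟩
        · rw [h]
          exact ⟨hw₂W, key w₂ w₁ hw₂W hw₁W hw12 hw₂cl⟩
  have hfilt : ∀ k : ℕ, (biIndepSets N k).filter (fun W => x ∉ W ∧ x ∈ clF N W ∧ fundC N W x = {w₁, w₂}) =
      (biIndepSets N k).filter (fun W => {w₁, w₂} ⊆ W ∧ x ∉ W) := by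
    intro k
    apply filter_congr
    intro W hW
    exact hclass k W hW
  rw [hfilt, hfilt]
  -- the matroid `N° := N ／ x ∖ w₁`
  have hgr₀ : gr ((N ／ ({x} : Set α)) ＼ ({w₁} : Set α)) = ((gr N).erase x).erase w₁ := by
    rw [gr_delete', gr_contract']
  have hxind : N.Indep ({x} : Set α) := by
    have hx1 : rk N {x} = 1 := by
      have h := rk_eq_card_of_subset_of_rk_eq_card (singleton_subset_iff.2 (mem_sdiff.2 ⟨hxg, hxW₀⟩)) hW₀compl
      rwa [card_singleton] at h
    have := indep_of_rk_eq_card' (M := N) (X := {x}) (by rw [hx1, card_singleton])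
    simpa using this
  have hrk₀ : ∀ X : Finset α, X ⊆ ((gr N).erase x).erase w₁ →
      rk ((N ／ ({x} : Set α)) ＼ ({w₁} : Set α)) X + 1 = rk N (insert x X) := by
    intro X hX
    have hX' : X ⊆ (gr (N ／ ({x} : Set α))).erase w₁ := by rw [gr_contract']; exact hX
    have hX'' : X ⊆ (gr N).erase x := hX.trans (erase_subset _ _)
    rw [rk_delete hX', rk_contract_add_one hxind hX'']
  have hcard₀ : (((gr N).erase x).erase w₁).card = (gr N).card - 2 := by
    rw [card_erase_of_mem (mem_erase.2 ⟨fun h => hxw₁ h.symm, hw₁g⟩), card_erase_of_mem hxg]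
    omega
  have hrkg₀ : rk ((N ／ ({x} : Set α)) ＼ ({w₁} : Set α)) (((gr N).erase x).erase w₁) = rk N (gr N) - 1 := by
    have h := hrk₀ _ (Subset.refl _)
    have e : insert x (((gr N).erase x).erase w₁) = (gr N).erase w₁ := by
      ext a
      simp only [mem_insert, mem_erase]
      constructor
      · rintro (rfl | ⟨haw, _, hag⟩)
        · exact ⟨hxw₁, hxg⟩
        · exact ⟨haw, hag⟩
      · rintro ⟨haw, hag⟩
        by_cases hax : a = x
        · exact Or.inl hax
        · exact Or.inr ⟨haw, hax, hag⟩
    have hw₁cl' : w₁ ∈ clF N ((gr N).erase w₁) :=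
      mem_clF_of_subset (insert_subset (mem_erase.2 ⟨hxw₁, hxg⟩)
        (singleton_subset_iff.2 (mem_erase.2 ⟨hw12.symm, hw₂g⟩))) hw₁cl
    have h2 : rk N (insert w₁ ((gr N).erase w₁)) = rk N ((gr N).erase w₁) := by
      rw [rk_insert_eq hw₁g (erase_subset w₁ (gr N)), if_pos hw₁cl']
    rw [insert_erase hw₁g] at h2
    rw [e, ← h2] at h
    omega
  -- the bijection `W ↦ W − w₁` onto the `w₂`-containing bi-independent sets of `N°`, at every level `k ≥ 1`
  have hbij : ∀ k : ℕ, 1 ≤ k →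
      ((biIndepSets N k).filter (fun W => {w₁, w₂} ⊆ W ∧ x ∉ W)).card =
        ((biIndepSets ((N ／ ({x} : Set α)) ＼ ({w₁} : Set α)) (k - 1)).filter (fun X => w₂ ∈ X)).card := by
    intro k hk
    apply card_nbij' (fun W => W.erase w₁) (fun X => insert w₁ X)
    · intro W hW
      rw [mem_coe, mem_filter, mem_biIndepSets] at hW
      obtain ⟨⟨hWg, hWcard, hWrk, hWcompl⟩, hCW, hxW⟩ := hW
      have hw₁W : w₁ ∈ W := hCW (mem_insert_self _ _)
      have hw₂W : w₂ ∈ W := hCW (mem_insert_of_mem (mem_singleton_self _))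
      rw [mem_coe, mem_filter, mem_biIndepSets, hgr₀]
      simp only
      have hWeg : W.erase w₁ ⊆ ((gr N).erase x).erase w₁ := by
        intro a ha
        rw [mem_erase] at ha
        exact mem_erase.2 ⟨ha.1, mem_erase.2 ⟨fun h => hxW (h ▸ ha.2), hWg ha.2⟩⟩
      refine ⟨⟨hWeg, ?_, ?_, ?_⟩, mem_erase.2 ⟨hw12.symm, hw₂W⟩⟩
      · rw [card_erase_of_mem hw₁W, hWcard]
      · have h := hrk₀ (W.erase w₁) hWeg
        have hw₁cl'' : w₁ ∈ clF N (insert x (W.erase w₁)) :=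
          mem_clF_of_subset (insert_subset_insert x (singleton_subset_iff.2 (mem_erase.2 ⟨hw12.symm, hw₂W⟩))) hw₁cl
        have r1 : rk N (insert w₁ (insert x (W.erase w₁))) = rk N (insert x (W.erase w₁)) := by
          rw [rk_insert_eq hw₁g (insert_subset hxg ((erase_subset _ _).trans hWg)), if_pos hw₁cl'']
        have e : insert w₁ (insert x (W.erase w₁)) = insert x W := by
          ext a
          simp only [mem_insert, mem_erase]
          constructor
          · rintro (rfl | rfl | ⟨_, h⟩)
            · exact Or.inr hw₁W
            · exact Or.inl rfl
            · exact Or.inr h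
          · rintro (rfl | h)
            · exact Or.inr (Or.inl rfl)
            · by_cases haw : a = w₁
              · exact Or.inl haw
              · exact Or.inr (Or.inr ⟨haw, h⟩)
        have r3 : rk N (insert x W) = rk N W := by
          rw [rk_insert_eq hxg hWg, if_pos (mem_clF_of_subset hCW hxcl12)]
        rw [e, r3, hWrk] at r1
        rw [card_erase_of_mem hw₁W]
        omega
      · have e : ((gr N).erase x).erase w₁ \ W.erase w₁ = (gr N \ W).erase x := by
          ext a
          simp only [mem_sdiff, mem_erase]
          constructor
          · rintro ⟨⟨haw, hax, hag⟩, h⟩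
            exact ⟨hax, hag, fun haW => h ⟨haw, haW⟩⟩
          · rintro ⟨hax, hag, haW⟩
            exact ⟨⟨fun h => haW (h ▸ hw₁W), hax, hag⟩, fun h => haW h.2⟩
        rw [e]
        have hYg : (gr N \ W).erase x ⊆ ((gr N).erase x).erase w₁ := by rw [← e]; exact sdiff_subset
        have h := hrk₀ _ hYg
        have eY : insert x ((gr N \ W).erase x) = gr N \ W := insert_erase (mem_sdiff.2 ⟨hxg, hxW⟩)
        rw [eY, hWcompl] at h
        have : 0 < (gr N \ W).card := card_pos.2 ⟨x, mem_sdiff.2 ⟨hxg, hxW⟩⟩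
        rw [card_erase_of_mem (mem_sdiff.2 ⟨hxg, hxW⟩)]
        omega
    · intro X hX
      rw [mem_coe, mem_filter, mem_biIndepSets, hgr₀] at hX
      obtain ⟨⟨hXg, hXcard, hXrk, hXcompl⟩, hw₂X⟩ := hX
      have hw₁X : w₁ ∉ X := fun h => (mem_erase.1 (hXg h)).1 rfl
      have hxX : x ∉ X := fun h => (mem_erase.1 (mem_erase.1 (hXg h)).2).1 rfl
      have hXg' : X ⊆ gr N := hXg.trans ((erase_subset _ _).trans (erase_subset _ _))
      rw [mem_coe, mem_filter, mem_biIndepSets]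
      simp only
      refine ⟨⟨insert_subset hw₁g hXg', ?_, ?_, ?_⟩, ?_, ?_⟩
      · rw [card_insert_of_notMem hw₁X, hXcard]
        omega
      · have h := hrk₀ X hXg
        rw [hXrk, hXcard] at h
        have hxcl' : x ∈ clF N (insert w₁ X) :=
          mem_clF_of_subset (insert_subset (mem_insert_self _ _)
            (singleton_subset_iff.2 (mem_insert_of_mem hw₂X))) hxcl12
        have hw₁cl' : w₁ ∈ clF N (insert x X) :=
          mem_clF_of_subset (insert_subset (mem_insert_self _ _)
            (singleton_subset_iff.2 (mem_insert_of_mem hw₂X))) hw₁cl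
        have r1 : rk N (insert x (insert w₁ X)) = rk N (insert w₁ X) := by
          rw [rk_insert_eq hxg (insert_subset hw₁g hXg'), if_pos hxcl']
        have r2 : rk N (insert w₁ (insert x X)) = rk N (insert x X) := by
          rw [rk_insert_eq hw₁g (insert_subset hxg hXg'), if_pos hw₁cl']
        have e : insert x (insert w₁ X) = insert w₁ (insert x X) := by
          ext a; simp only [mem_insert]; tauto
        rw [e, r2] at r1
        rw [card_insert_of_notMem hw₁X, ← r1]
        omega
      · have e : gr N \ insert w₁ X = insert x (((gr N).erase x).erase w₁ \ X) := by
          ext a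
          simp only [mem_sdiff, mem_insert, mem_erase, not_or]
          constructor
          · rintro ⟨hag, haw, haX⟩
            by_cases hax : a = x
            · exact Or.inl hax
            · exact Or.inr ⟨⟨haw, hax, hag⟩, haX⟩
          · rintro (rfl | ⟨⟨haw, hax, hag⟩, haX⟩)
            · exact ⟨hxg, hxw₁, hxX⟩
            · exact ⟨hag, haw, haX⟩
        rw [e]
        have hYg : ((gr N).erase x).erase w₁ \ X ⊆ ((gr N).erase x).erase w₁ := sdiff_subset
        have h := hrk₀ _ hYg
        have hxY : x ∉ ((gr N).erase x).erase w₁ \ X :=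
          fun h => (mem_erase.1 (mem_erase.1 (mem_sdiff.1 h).1).2).1 rfl
        rw [hXcompl] at h
        rw [card_insert_of_notMem hxY]
        omega
      · exact insert_subset (mem_insert_self _ _) (singleton_subset_iff.2 (mem_insert_of_mem hw₂X))
      · exact fun h => hxX ((mem_insert.1 h).resolve_left hxw₁)
    · intro W hW
      rw [mem_coe, mem_filter] at hW
      exact insert_erase (hW.2.1 (mem_insert_self _ _))
    · intro X hX
      rw [mem_coe, mem_filter, mem_biIndepSets, hgr₀] at hX
      have hw₁X : w₁ ∉ X := fun h => (mem_erase.1 (hX.1.1 h)).1 rfl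
      exact erase_insert hw₁X
  rw [hbij 5 (by norm_num), hbij ((gr N).card - 6) (by omega)]
  -- the in–out inequality on `N°`
  have hn₀ : (gr ((N ／ ({x} : Set α)) ＼ ({w₁} : Set α))).card =
      rk ((N ／ ({x} : Set α)) ＼ ({w₁} : Set α)) (gr ((N ／ ({x} : Set α)) ＼ ({w₁} : Set α))) + 4 := by
    rw [hgr₀, hcard₀, hrkg₀]
    omega
  have hR₀ : 6 ≤ rk ((N ／ ({x} : Set α)) ＼ ({w₁} : Set α)) (gr ((N ／ ({x} : Set α)) ＼ ({w₁} : Set α))) := by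
    rw [hgr₀, hrkg₀]
    omega
  have hw₂g₀ : w₂ ∈ gr ((N ／ ({x} : Set α)) ＼ ({w₁} : Set α)) := by
    rw [hgr₀]
    exact mem_erase.2 ⟨hw12.symm, mem_erase.2 ⟨fun h => hxw₂ h.symm, hw₂g⟩⟩
  have hio' := hio ((N ／ ({x} : Set α)) ＼ ({w₁} : Set α)) w₂ hw₂g₀ hn₀ hR₀
  have hsym := inCount_sub_eq_outCount (M := (N ／ ({x} : Set α)) ＼ ({w₁} : Set α)) (k := 5) hw₂g₀
    (by rw [hgr₀, hcard₀]; omega)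
  rw [hgr₀, hcard₀] at hsym
  have e1 : (5 : ℕ) - 1 = 4 := by norm_num
  have e2 : (gr N).card - 6 - 1 = (gr N).card - 2 - 5 := by omega
  rw [e1, e2]
  unfold inCount outCount at hio' hsym
  rw [hsym]
  exact hio'

end FiveTwo

end PercRepro.Cogirth
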